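import Mathlib
import Summits.NavierStokesRegularity.OSWSelfSimilar.EfoldClockDictionary
import HarnessLib

/-!
# The FRONT-STEEPNESS CLOCK of a transported scalar on an invariant plane:
# `d/dt log G₀ = −∂ᵣu^r(r_G)` exactly, the e-fold identity `τ_k · ⟨s⟩_k = 1`, and what the (T1) ratio test measures

HONEST FRAMING (cell ns-blowup GROUP B «PROFILE SEARCH», zone Z8 «Hou–Luo corner analogue WITHOUT the wall», cases Z8-1L′/L″/
L‴/L⁗/L⁵ of the wall-free axisymmetric EULER-with-swirl (D)-class MODEL runs of engine B «e14ax»; human rulings D-0035/D-0074/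
D-0081): **one-variable calculus at a point (product rule, chain rule, fundamental theorem of calculus) kernel-checked; the
transport identity on the plane and the smoothness of the traces are HYPOTHESES; nothing here asserts that any run obeys them,
and nothing is a statement about Euler or Navier–Stokes blow-up; «violates: none — no object / dictionary».**

THE IDENTITY (profile-eng-14 g2 K-NOTE, STATUS l.7013, re-tallied by profile-refuter-1 g2 §1.26; the (p3) print of
PREREG-Z8-1L3/L4/L5 §4): on the invariant plane `{z = 0}` of a class-E axisymmetric Euler flow (`u^z = 0` there) the swirl
`Γ = r u^θ` is TRANSPORTED along the plane at `ν = 0`, `∂ₜΓ + u^r ∂ᵣΓ = 0` (the plane instance of `DΓ/Dt = 0`; tree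
`HouLuoMirrorPlaneGerm.swirl_eq_on_plane` is the Hou–Li form). Differentiating once in `r` (§1, `transport_gradient_at_point`):
`∂ᵣ∂ₜΓ + (∂ᵣu^r) ∂ᵣΓ + u^r ∂ᵣ²Γ = 0`; at an interior extremum `r_G(t)` of the steepness `∂ᵣΓ(·, t)` the last term drops
(`∂ᵣ²Γ(r_G) = 0`, `steepness_rate_at_isLocalExtr`), WITHOUT `u^r(r_G) = 0` (the argmax `r_G` is not the stagnation ring `r₀`);
and the ENVELOPE step (§2, `envelope_hasDerivAt`: a `C¹` function of `(r, t)` evaluated along ANY differentiable curve through a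
critical point of its `r`-slice has time derivative = its `t`-partial) turns this into the clock law for
`G₀(t) := ∂ᵣΓ(r_G(t), t)`:  **`Ġ₀ = s · G₀` with `s(t) := −∂ᵣu^r(r_G(t), t)`** (`front_steepness_hasDerivAt`; Schwarz's
identification `∂ₜ∂ᵣΓ = ∂ᵣ∂ₜΓ` at the point enters as the hypothesis `hmixed`). CONSEQUENCES typed in §3 (with the tree's
`EfoldClockDictionary`): over any interval on which `G₀ > 0` has logarithmic derivative `s`, `∫ s = log G₀(b) − log G₀(a)`
(`integral_strain_eq_log_sub_log`), so over one e-fold `∫ s = 1` and `τ · s̄ = 1` EXACTLY (`efold_integral_strain_eq_one`,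
`efold_duration_mul_meanStrain`): the scorer's (p3) print `τ_k × ⟨−∂ᵣu_r(r_G⁰)⟩_k = 1.02 / 1.00 / 0.93, 0.98 / 1.00 / 1.01` is a
CUSTODY CHECK of this identity (quadrature + 5-output estimators), not a dynamical finding; and the (T1) ratio of consecutive
e-fold durations IS the inverse ratio of consecutive e-fold-MEAN STRAINS (`efold_ratio_eq_meanStrain_ratio`): KEEP-shape
`τ_{k+1}/τ_k ≤ 4/5` ⇔ the mean front strain grows by `≥ 25 %` per e-fold (`keepShape_iff_meanStrain_growth`), KILL band
`[9/10, 11/10]` ⇔ it changes by a factor in `[10/11, 10/9]` per e-fold (`killBand_iff_meanStrain_band`). So the registered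
question «accelerating clock or not» is, exactly, «does the compressive strain AT THE FRONT grow geometrically e-fold over
e-fold, or saturate» — the words «EXPONENTIAL AT THE SATURATED STRAIN» (ending (i)) and «KILL-shape (T1)» are the same
statement read twice.
WHAT IS NOT PROVED HERE: that any engine run satisfies the transport identity or is smooth (CUSTODY is what the 0.990–1.031
print measures); existence of the argmax curve `r_G(t)` or its differentiability (hypotheses); anything at `ν > 0` (there
`DΓ/Dt = ν(Δ − (2/r)∂ᵣ)Γ` adds a term and the identity becomes an inequality-free bookkeeping with a viscous remainder — not
typed); anything about NS. PLACEMENT: cell-own calculus next to `HouLuoMirrorPlaneGerm` / `EfoldClockDictionary`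
(profile-eng-14 g6, Z8 engine-B seat, 0 kit). bears on LADDER-NS N5 / zone Z8 (F-Z8-e reading rule; custody tier of the
Z8-1L endings) → N1 linear core.
-/

open Real Filter Topology Set MeasureTheory intervalIntegral

namespace Summit.NavierStokesRegularity.OSWSelfSimilar
namespace PlaneFrontSteepnessClock

/-! ### §1 The transported scalar differentiated once in `r` at a point -/

/-- **Transport on the plane, differentiated in `r` at `r_G`.** Fix `t` and regard the traces as functions of `r`:
`Γt = ∂ₜΓ(·, t)`, `U = u^r(·, 0, t)`, `dΓ = ∂ᵣΓ(·, t)`. If `Γt r + U r · dΓ r = 0` for all `r` (the plane transport identity)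
and `Γt, U, dΓ` are differentiable at `r_G` with derivatives `Γtr, Ur, ddΓ`, then `Γtr + Ur · dΓ(r_G) + U(r_G) · ddΓ = 0`.
[new here — MODEL/custody bookkeeping; product rule at a point] -/
theorem transport_gradient_at_point (Γt U dΓ : ℝ → ℝ) (rG Γtr Ur ddΓ : ℝ)
    (hT : ∀ r, Γt r + U r * dΓ r = 0)
    (hΓt : HasDerivAt Γt Γtr rG) (hU : HasDerivAt U Ur rG) (hdΓ : HasDerivAt dΓ ddΓ rG) :
    Γtr + Ur * dΓ rG + U rG * ddΓ = 0 := by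
  have hL : HasDerivAt (fun r => Γt r + U r * dΓ r) (Γtr + (Ur * dΓ rG + U rG * ddΓ)) rG :=
    hΓt.add (hU.mul hdΓ)
  have hfun : (fun r => Γt r + U r * dΓ r) = fun _ => (0 : ℝ) := funext hT
  rw [hfun] at hL
  have h := hL.unique (hasDerivAt_const rG (0 : ℝ))
  linarith

/-- **At a critical point of the steepness the advective term drops.** Same hypotheses with `∂ᵣ(∂ᵣΓ)(r_G) = 0`:
`∂ᵣ∂ₜΓ(r_G) = −∂ᵣu^r(r_G) · ∂ᵣΓ(r_G)` — with NO assumption on `u^r(r_G)` (the argmax of the steepness is not the stagnation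
ring). [new here — MODEL/custody bookkeeping] -/
theorem steepness_rate_at_critical (Γt U dΓ : ℝ → ℝ) (rG Γtr Ur : ℝ)
    (hT : ∀ r, Γt r + U r * dΓ r = 0)
    (hΓt : HasDerivAt Γt Γtr rG) (hU : HasDerivAt U Ur rG) (hdΓ : HasDerivAt dΓ 0 rG) :
    Γtr = -Ur * dΓ rG := by
  have h := transport_gradient_at_point Γt U dΓ rG Γtr Ur 0 hT hΓt hU hdΓ
  linear_combination h

/-- **At a local extremum of the steepness** (`r_G` a local max or min of `∂ᵣΓ(·, t)`, differentiable there): the derivative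
vanishes (Fermat) and `∂ᵣ∂ₜΓ(r_G) = −∂ᵣu^r(r_G) · ∂ᵣΓ(r_G)`. [new here — MODEL/custody bookkeeping] -/
theorem steepness_rate_at_isLocalExtr (Γt U dΓ : ℝ → ℝ) (rG Γtr Ur ddΓ : ℝ)
    (hT : ∀ r, Γt r + U r * dΓ r = 0)
    (hΓt : HasDerivAt Γt Γtr rG) (hU : HasDerivAt U Ur rG) (hdΓ : HasDerivAt dΓ ddΓ rG)
    (hext : IsLocalExtr dΓ rG) : Γtr = -Ur * dΓ rG := by
  have h0 : ddΓ = 0 := hext.hasDerivAt_eq_zero hdΓ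
  rw [h0] at hdΓ
  exact steepness_rate_at_critical Γt U dΓ rG Γtr Ur hT hΓt hU hdΓ

/-- **The argmax of `|∂ᵣΓ|` is a local extremum of `∂ᵣΓ`.** A local maximum of `|g|` is a local maximum of `g` (if `g ≥ 0`
there) or a local minimum (if `g < 0` there); either way a local extremum — so the scorer's `G₀ = max_r |∂ᵣΓ(r, 0, t)|`, read at an
interior argmax, is covered by `steepness_rate_at_isLocalExtr`. [folklore] -/
theorem isLocalExtr_of_isLocalMax_abs (g : ℝ → ℝ) (r : ℝ) (h : IsLocalMax (fun x => |g x|) r) : IsLocalExtr g r := by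
  rcases le_or_gt 0 (g r) with hpos | hneg
  · have h' : IsLocalMax g r := by
      filter_upwards [h] with x hx
      calc g x ≤ |g x| := le_abs_self _
        _ ≤ |g r| := hx
        _ = g r := abs_of_nonneg hpos
    exact h'.isExtr
  · have h' : IsLocalMin g r := by
      filter_upwards [h] with x hx
      have h1 : -|g x| ≤ g x := neg_abs_le _
      have h2 : |g r| = -g r := abs_of_neg hneg
      linarith
    exact h'.isExtr

/-! ### §2 The envelope step: evaluating along a curve through a critical point of the slice -/

/-- **ENVELOPE LEMMA (at a point).** Let `g : ℝ × ℝ → ℝ` be Fréchet-differentiable at `(r_G(t), t)` with derivative `L`, let the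
curve `r_G` be differentiable at `t` (ANY velocity `v`), and let the `r`-partial vanish there, `L (1, 0) = 0`. Then
`s ↦ g(r_G(s), s)` has derivative `L (0, 1)` (the `t`-partial) at `t`: the motion of the argmax does not contribute.
[folklore — chain rule] -/
theorem envelope_hasDerivAt (g : ℝ × ℝ → ℝ) (L : ℝ × ℝ →L[ℝ] ℝ) (rG : ℝ → ℝ) (v t : ℝ)
    (hg : HasFDerivAt g L (rG t, t)) (hrG : HasDerivAt rG v t) (hcrit : L (1, 0) = 0) :
    HasDerivAt (fun s => g (rG s, s)) (L (0, 1)) t := by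
  have hc : HasDerivAt (fun s => (rG s, s)) (v, 1) t := hrG.prodMk (hasDerivAt_id t)
  have h : HasDerivAt (fun s => g (rG s, s)) (L (v, 1)) t :=
    HasFDerivAt.comp_hasDerivAt (f := fun s => (rG s, s)) t hg hc
  have hlin : L (v, 1) = L (0, 1) := by
    have hsplit : ((v, 1) : ℝ × ℝ) = v • ((1, 0) : ℝ × ℝ) + ((0, 1) : ℝ × ℝ) := by
      ext <;> simp
    rw [hsplit, map_add, map_smul, hcrit, smul_zero, zero_add]
  exact h.congr_deriv hlin

/-- **The `r`-slice of `g` at a critical point.** If `g` has Fréchet derivative `L` at `(r, t)` then the slice `x ↦ g(x, t)` has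
derivative `L (1, 0)` at `r`. [folklore — chain rule] -/
theorem slice_hasDerivAt (g : ℝ × ℝ → ℝ) (L : ℝ × ℝ →L[ℝ] ℝ) (r t : ℝ) (hg : HasFDerivAt g L (r, t)) :
    HasDerivAt (fun x => g (x, t)) (L (1, 0)) r := by
  have hc : HasDerivAt (fun x : ℝ => (x, t)) (1, 0) r := (hasDerivAt_id r).prodMk (hasDerivAt_const r t)
  exact HasFDerivAt.comp_hasDerivAt (f := fun x : ℝ => (x, t)) r hg hc

/-- **THE FRONT-STEEPNESS CLOCK LAW `Ġ₀ = −∂ᵣu^r(r_G) · G₀`.** Let `g(r, t)` stand for `∂ᵣΓ(r, t)` on the plane, Fréchet-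
differentiable at `(r_G(t), t)` with derivative `L`, `r`-critical there (`L (1, 0) = 0`: `r_G(t)` is an interior extremum of the
steepness), evaluated along a differentiable argmax curve `r_G`. At the fixed time `t` let `Γt, U` be the `r`-traces of `∂ₜΓ`,
`u^r` with the plane transport identity `Γt + U · g(·, t) = 0` and derivatives `Γtr, Ur` at `r_G(t)`, and identify the mixed
partial `L (0, 1) = ∂ₜ∂ᵣΓ(r_G, t)` with `Γtr = ∂ᵣ∂ₜΓ(r_G, t)` (Schwarz — hypothesis `hmixed`). Then
`G₀(s) := g(r_G(s), s)` has derivative `−Ur · G₀(t)` at `t`: **`d/dt log G₀ = −∂ᵣu^r(r_G)` exactly** (profile-eng-14 g2's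
kinematic identity, STATUS l.7013). [new here — MODEL/custody bookkeeping] -/
theorem front_steepness_hasDerivAt (g : ℝ × ℝ → ℝ) (L : ℝ × ℝ →L[ℝ] ℝ) (rG : ℝ → ℝ) (v t : ℝ)
    (Γt U : ℝ → ℝ) (Γtr Ur : ℝ)
    (hg : HasFDerivAt g L (rG t, t)) (hrG : HasDerivAt rG v t) (hcrit : L (1, 0) = 0)
    (hmixed : L (0, 1) = Γtr)
    (hT : ∀ r, Γt r + U r * g (r, t) = 0)
    (hΓt : HasDerivAt Γt Γtr (rG t)) (hU : HasDerivAt U Ur (rG t)) :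
    HasDerivAt (fun s => g (rG s, s)) (-Ur * g (rG t, t)) t := by
  have hslice : HasDerivAt (fun x => g (x, t)) 0 (rG t) := by
    have h := slice_hasDerivAt g L (rG t) t hg
    rwa [hcrit] at h
  have hrate : Γtr = -Ur * g (rG t, t) :=
    steepness_rate_at_critical Γt U (fun x => g (x, t)) (rG t) Γtr Ur hT hΓt hU hslice
  have henv := envelope_hasDerivAt g L rG v t hg hrG hcrit
  rw [hmixed, hrate] at henv
  exact henv

/-! ### §3 The e-fold identities: `∫ s = log G₀(b) − log G₀(a)`, `τ · s̄ = 1`, ratio of durations = inverse ratio of mean strains -/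

/-- **`∫_a^b s = log G₀(b) − log G₀(a)`** when `G₀ > 0` has logarithmic derivative `s` on `[a, b]` (`G₀′ = s · G₀` as `HasDerivAt`
facts on `uIcc a b`) and `s` is interval-integrable. (FTC for `log ∘ G₀`.) [folklore] -/
theorem integral_strain_eq_log_sub_log (G s : ℝ → ℝ) (a b : ℝ)
    (hderiv : ∀ x ∈ uIcc a b, HasDerivAt G (s x * G x) x) (hpos : ∀ x ∈ uIcc a b, 0 < G x)
    (hint : IntervalIntegrable s volume a b) :
    ∫ x in a..b, s x = Real.log (G b) - Real.log (G a) := by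
  have hlog : ∀ x ∈ uIcc a b, HasDerivAt (fun y => Real.log (G y)) (s x) x := by
    intro x hx
    have h := (hderiv x hx).log (hpos x hx).ne'
    have hs : s x * G x / G x = s x := by field_simp [(hpos x hx).ne']
    rwa [hs] at h
  exact integral_eq_sub_of_hasDerivAt hlog hint

/-- **OVER ONE E-FOLD, `∫ s = 1`.** If in addition `G₀(b) = e · G₀(a)`, then `∫_a^b s = 1`. [folklore] -/
theorem efold_integral_strain_eq_one (G s : ℝ → ℝ) (a b : ℝ)
    (hderiv : ∀ x ∈ uIcc a b, HasDerivAt G (s x * G x) x) (hpos : ∀ x ∈ uIcc a b, 0 < G x)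
    (hint : IntervalIntegrable s volume a b) (hfold : G b = Real.exp 1 * G a) :
    ∫ x in a..b, s x = 1 := by
  rw [integral_strain_eq_log_sub_log G s a b hderiv hpos hint, hfold,
    Real.log_mul (Real.exp_pos 1).ne' (hpos a left_mem_uIcc).ne', Real.log_exp]
  ring

/-- **`τ · s̄ = 1` EXACTLY** (the (p3) print): with `τ = b − a > 0` and the e-fold MEAN strain `s̄ := τ⁻¹ ∫_a^b s`, `τ · s̄ = 1`.
The printed values `1.02 / 1.00 / 0.93`, `0.98 / 1.00 / 1.01` therefore measure quadrature/estimator error (custody), not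
dynamics. [folklore] -/
theorem efold_duration_mul_meanStrain (G s : ℝ → ℝ) (a b : ℝ) (hab : a < b)
    (hderiv : ∀ x ∈ uIcc a b, HasDerivAt G (s x * G x) x) (hpos : ∀ x ∈ uIcc a b, 0 < G x)
    (hint : IntervalIntegrable s volume a b) (hfold : G b = Real.exp 1 * G a) :
    (b - a) * ((b - a)⁻¹ * ∫ x in a..b, s x) = 1 := by
  rw [efold_integral_strain_eq_one G s a b hderiv hpos hint hfold]
  have hne : b - a ≠ 0 := by linarith
  field_simp

/-- **RATIO OF CONSECUTIVE E-FOLD DURATIONS = INVERSE RATIO OF THEIR MEAN STRAINS.** If `τ₁ s̄₁ = 1` and `τ₂ s̄₂ = 1` with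
`τ₁, s̄₂ ≠ 0` then `τ₂/τ₁ = s̄₁/s̄₂`: the (T1) statistic is a statistic of the e-fold-averaged front strain and of nothing else.
[new here — dictionary; algebra] -/
theorem efold_ratio_eq_meanStrain_ratio (τ₁ τ₂ s₁ s₂ : ℝ) (hτ₁ : τ₁ ≠ 0) (hs₂ : s₂ ≠ 0)
    (h₁ : τ₁ * s₁ = 1) (h₂ : τ₂ * s₂ = 1) : τ₂ / τ₁ = s₁ / s₂ := by
  rw [div_eq_div_iff hτ₁ hs₂]
  linear_combination h₂ - h₁

/-- **(T1) KEEP-shape ⇔ the mean front strain grows by at least a quarter per e-fold.** With `τ₁ s̄₁ = τ₂ s̄₂ = 1` and positive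
quantities: `τ₂/τ₁ ≤ 4/5 ⇔ (5/4) s̄₁ ≤ s̄₂`. [new here — dictionary; algebra] -/
theorem keepShape_iff_meanStrain_growth (τ₁ τ₂ s₁ s₂ : ℝ) (hτ₁ : 0 < τ₁) (hs₂ : 0 < s₂)
    (h₁ : τ₁ * s₁ = 1) (h₂ : τ₂ * s₂ = 1) : τ₂ / τ₁ ≤ 4 / 5 ↔ 5 / 4 * s₁ ≤ s₂ := by
  rw [efold_ratio_eq_meanStrain_ratio τ₁ τ₂ s₁ s₂ hτ₁.ne' hs₂.ne' h₁ h₂, div_le_iff₀ hs₂]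
  constructor
  · intro h
    linarith
  · intro h
    linarith

/-- **(T1) KILL band ⇔ the mean front strain changes by a factor in `[10/11, 10/9]` per e-fold.** With `τ₁ s̄₁ = τ₂ s̄₂ = 1` and
positive quantities: `9/10 ≤ τ₂/τ₁ ≤ 11/10 ⇔ (10/11) s̄₁ ≤ s̄₂ ≤ (10/9) s̄₁` — «exponential at the SATURATED strain» and
«KILL-shape» are one statement. [new here — dictionary; algebra] -/
theorem killBand_iff_meanStrain_band (τ₁ τ₂ s₁ s₂ : ℝ) (hτ₁ : 0 < τ₁) (hs₂ : 0 < s₂)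
    (h₁ : τ₁ * s₁ = 1) (h₂ : τ₂ * s₂ = 1) :
    (9 / 10 ≤ τ₂ / τ₁ ∧ τ₂ / τ₁ ≤ 11 / 10) ↔ (10 / 11 * s₁ ≤ s₂ ∧ s₂ ≤ 10 / 9 * s₁) := by
  rw [efold_ratio_eq_meanStrain_ratio τ₁ τ₂ s₁ s₂ hτ₁.ne' hs₂.ne' h₁ h₂, le_div_iff₀ hs₂, div_le_iff₀ hs₂]
  constructor
  · rintro ⟨ha, hb⟩
    constructor <;> linarith
  · rintro ⟨ha, hb⟩
    constructor <;> linarith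

/-- **A SATURATED FRONT STRAIN FORBIDS AN ACCELERATING CLOCK (floor form).** If along an e-fold `[a, b]` the clock law holds with
`s ≤ s_max` (`G₀′ = s G₀ ≤ s_max G₀`, `s_max > 0`), then `b − a ≥ 1/s_max` — every e-fold under a strain ceiling lasts at least
`1/s_max`, so consecutive durations cannot shrink geometrically while the ceiling holds (tree `EfoldClockDictionary`, §3–§4).
[new here — dictionary; instance of `EfoldClockDictionary.efold_duration_ge_inv_strain`] -/
theorem efold_duration_ge_inv_strainCeiling (G s : ℝ → ℝ) (smax a b : ℝ) (hs : 0 < smax) (hab : a ≤ b)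
    (hderiv : ∀ x ∈ Icc a b, HasDerivAt G (s x * G x) x) (hpos : ∀ x ∈ Icc a b, 0 < G x)
    (hceil : ∀ x ∈ Ioo a b, s x ≤ smax) (hfold : Real.exp 1 * G a ≤ G b) : 1 / smax ≤ b - a := by
  have hcont : ContinuousOn G (Icc a b) := fun x hx => (hderiv x hx).continuousAt.continuousWithinAt
  have hderiv' : ∀ x ∈ Ioo a b, HasDerivAt G (s x * G x) x := fun x hx => hderiv x (Ioo_subset_Icc_self hx)
  have hrate : ∀ x ∈ Ioo a b, s x * G x ≤ smax * G x := fun x hx =>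
    mul_le_mul_of_nonneg_right (hceil x hx) (hpos x (Ioo_subset_Icc_self hx)).le
  exact EfoldClockDictionary.efold_duration_ge_inv_strain G (fun x => s x * G x) smax a b hs hab hcont hderiv' hpos
    hrate hfold

end PlaneFrontSteepnessClock
end Summit.NavierStokesRegularity.OSWSelfSimilar
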